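import Summits.Parity.BatemanHorn.Theorems.AlmostPrimeZerosSystemLSDRealSegmentNairRankin
import Summits.Parity.BatemanHorn.Theorems.AlmostPrimeZerosSystemLSDRealSegmentNairCut
import HarnessLib

/-!
# Nair–Tenenbaum light, VII: the power-saving classes 0, II, III

Crux `SystemLSDRealSegment` (stmt-Parity-11292, route `AlmostPrimeZeros`), line `beta-thinned-root-kernel`,
support programme of the lead c8: **Nair–Tenenbaum "light"** — the sharp-order upper bound
`Σ_{1≤n≤N} G(F(n)) ≤ C · N · exp(Σ_{p≤N} (G(p) − 1) ρ_F(p)/p)` for a polynomial `F ∈ ℤ[X]` (degree `≥ 1`, positive on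
`ℕ_{≥1}`, root counts `ρ_F(p) ≤ D`, `ρ_F(p) < p`, `ρ_F(p^a) ≤ M`) and every weight `G ≥ 0`, `G(1) = 1`, multiplicative on
coprime arguments with `G(p^v) ≤ A` (M. Nair, Acta Arith. 62 (1992); Nair–Tenenbaum, Acta Math. 180 (1998), Thm 1 —
the special case of the class bounded at prime powers), by Shiu's method (J. reine angew. Math. 313 (1980), §5) run on the
values `m = F(n)`: cut `m = c·d` at `√N` (`Shiu.cutPrime/cPart/dPart`), four classes, the beta upper-bound sieve of dimension
`2D` on the root classes of `c`, Hall–Tenenbaum's Theorem 01 and Rankin's trick with a uniform exponent for the `c`-sums.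
Applied (file `…NairUpperBound`) to the product polynomial of a Bateman–Horn system with `G = y^{capped}` it gives
`Σ_{n≤x} y^{s_f(n)} ≪ x (log x)^{k(y−1)}`, i.e. `H_x(y) = O(1)` on the real segment — the upper half of the order of
magnitude predicted by the crux (lower half: `sumPowStat_lower_bound`, landed).  Everything here is PROVED; no definitions.

This file: small values (`≤ C N^{3/4}`), a large power of a small prime (`≤ C N^{5/6}`), a large smooth part with tiny cut prime (`≤ C(L) N^{23/24}`).
-/

open Finset Real Polynomial

namespace Summit.Parity.BatemanHorn.Cruxes.SystemLSDRealSegment.BetaThinnedRootKernel.Nair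

open Literature.NumberTheory.Sieve

noncomputable section

section Main

variable {F : ℤ[X]} {D M : ℕ} {A : ℝ}

/-- **Class 0** (small values `F(n) ≤ √N`): `Σ ≤ C N^{3/4}`. [folklore] -/
theorem class0_le (hd : 1 ≤ F.natDegree) (hA : 1 ≤ A) :
    ∃ C : ℝ, 0 < C ∧ ∀ G : ℕ → ℝ, (∀ n, 0 ≤ G n) → G 1 = 1 →
      (∀ m n : ℕ, m.Coprime n → G (m * n) = G m * G n) →
      (∀ p : ℕ, p.Prime → ∀ v : ℕ, 1 ≤ v → G (p ^ v) ≤ A) →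
      ∀ N : ℕ, 1 ≤ N →
        ∑ n ∈ (Icc 1 N).filter (fun n : ℕ => 0 < F.eval (n : ℤ) ∧ ((F.eval (n : ℤ)).toNat : ℝ) ≤ Real.sqrt N),
            G (F.eval (n : ℤ)).toNat ≤ C * (N : ℝ) ^ (3 / 4 : ℝ) := by
  obtain ⟨Cw, hCw1, hCw⟩ := exists_weight_le_rpow hA (show (0 : ℝ) < 1 / 2 by norm_num)
  set d := F.natDegree with hddef
  refine ⟨d * Cw, by have : (1 : ℝ) ≤ d := (by exact_mod_cast hd); positivity, ?_⟩
  intro G hG0 hG1 hGmul hGA N hN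
  set S := (Icc 1 N).filter (fun n : ℕ => 0 < F.eval (n : ℤ) ∧ ((F.eval (n : ℤ)).toNat : ℝ) ≤ Real.sqrt N)
    with hS
  have hN0 : (0 : ℝ) ≤ N := Nat.cast_nonneg _
  -- pointwise weight bound `G(F(n)) ≤ Cw N^{1/4}` on `S`
  have hpt : ∀ n ∈ S, G (F.eval (n : ℤ)).toNat ≤ Cw * (N : ℝ) ^ (1 / 4 : ℝ) := by
    intro n hn
    rw [hS, Finset.mem_filter] at hn
    obtain ⟨-, hpos, hle⟩ := hn
    set m := (F.eval (n : ℤ)).toNat with hm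
    have hm1 : 1 ≤ m := by
      rw [hm, Nat.one_le_iff_ne_zero, Ne, Int.toNat_eq_zero, not_le]; exact hpos
    refine (hCw G hG0 hG1 hGmul hGA m hm1).trans (mul_le_mul_of_nonneg_left ?_ (by linarith))
    calc (m : ℝ) ^ (1 / 2 : ℝ) ≤ (Real.sqrt N) ^ (1 / 2 : ℝ) :=
          Real.rpow_le_rpow (Nat.cast_nonneg _) hle (by norm_num)
      _ = (N : ℝ) ^ (1 / 4 : ℝ) := by
          rw [Real.sqrt_eq_rpow, ← Real.rpow_mul hN0]; norm_num
  -- cardinality `#S ≤ d √N`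
  have hcard : (#S : ℝ) ≤ d * Real.sqrt N := by
    have hsub : S ⊆ (Icc 1 N).filter (fun n : ℕ => 0 < F.eval (n : ℤ) ∧ F.eval (n : ℤ) ≤ (⌊Real.sqrt N⌋₊ : ℕ)) := by
      intro n hn
      rw [hS, Finset.mem_filter] at hn
      obtain ⟨hI, hpos, hle⟩ := hn
      refine Finset.mem_filter.2 ⟨hI, hpos, ?_⟩
      have h1 : (F.eval (n : ℤ)).toNat ≤ ⌊Real.sqrt N⌋₊ := Nat.le_floor hle
      have h2 : F.eval (n : ℤ) = ((F.eval (n : ℤ)).toNat : ℤ) := (Int.toNat_of_nonneg hpos.le).symm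
      rw [h2]; exact_mod_cast h1
    have h3 := (Finset.card_le_card hsub).trans (card_filter_eval_le_le hd N ⌊Real.sqrt N⌋₊)
    calc (#S : ℝ) ≤ ((d * ⌊Real.sqrt N⌋₊ : ℕ) : ℝ) := by exact_mod_cast h3
      _ = d * (⌊Real.sqrt N⌋₊ : ℝ) := by push_cast; ring
      _ ≤ d * Real.sqrt N := mul_le_mul_of_nonneg_left (Nat.floor_le (Real.sqrt_nonneg _)) (Nat.cast_nonneg _)
  calc ∑ n ∈ S, G (F.eval (n : ℤ)).toNat ≤ ∑ _n ∈ S, Cw * (N : ℝ) ^ (1 / 4 : ℝ) := Finset.sum_le_sum hpt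
    _ = #S * (Cw * (N : ℝ) ^ (1 / 4 : ℝ)) := by rw [Finset.sum_const, nsmul_eq_mul]
    _ ≤ (d * Real.sqrt N) * (Cw * (N : ℝ) ^ (1 / 4 : ℝ)) := mul_le_mul_of_nonneg_right hcard (by positivity)
    _ = d * Cw * (N : ℝ) ^ (3 / 4 : ℝ) := by
        rw [Real.sqrt_eq_rpow, show (3 / 4 : ℝ) = 1 / 2 + 1 / 4 by norm_num,
          Real.rpow_add' hN0 (by norm_num)]
        ring

/-- **Class II** (`P < N^{c₀}`, `c ≤ N^{1/4}`): `Σ ≤ C N^{5/6}`. [folklore] -/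
theorem class2_le (hd : 1 ≤ F.natDegree) (hpos : ∀ n : ℕ, 1 ≤ n → 0 < F.eval (n : ℤ)) (hD1 : 1 ≤ D)
    (hM : ∀ p : ℕ, p.Prime → ∀ a : ℕ, 1 ≤ a → polyRootCountMod ![F] (p ^ a) ≤ M) (hM1 : 1 ≤ M) (hA : 1 ≤ A) :
    ∃ C : ℝ, 0 < C ∧ ∀ G : ℕ → ℝ, (∀ n, 0 ≤ G n) → G 1 = 1 →
      (∀ m n : ℕ, m.Coprime n → G (m * n) = G m * G n) →
      (∀ p : ℕ, p.Prime → ∀ v : ℕ, 1 ≤ v → G (p ^ v) ≤ A) →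
      ∀ N : ℕ, 2 ≤ N →
        ∑ n ∈ (Icc 1 N).filter (fun n : ℕ => Real.sqrt N < (F.eval (n : ℤ)).toNat ∧
              (Shiu.cutPrime (Real.sqrt N) (F.eval (n : ℤ)).toNat : ℝ) < (N : ℝ) ^ (1 / (4 * (18 * (D : ℝ) + 1))) ∧
              (Shiu.cPart (Real.sqrt N) (F.eval (n : ℤ)).toNat : ℝ) ≤ (N : ℝ) ^ (1 / 4 : ℝ)),
            G (F.eval (n : ℤ)).toNat ≤ C * (N : ℝ) ^ (5 / 6 : ℝ) := by
  obtain ⟨Cg, hCg, hW⟩ := weight_global_le hd hA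
  refine ⟨4 * M * Cg, by positivity, ?_⟩
  intro G hG0 hG1 hGmul hGA N hN
  set e₀ : ℝ := 1 / (4 * (18 * (D : ℝ) + 1)) with he₀
  set z₀ : ℝ := (N : ℝ) ^ e₀ with hz₀
  set T : ℝ := (N : ℝ) ^ (1 / 4 : ℝ) with hT
  set S := (Icc 1 N).filter (fun n : ℕ => Real.sqrt N < (F.eval (n : ℤ)).toNat ∧
      (Shiu.cutPrime (Real.sqrt N) (F.eval (n : ℤ)).toNat : ℝ) < z₀ ∧
      (Shiu.cPart (Real.sqrt N) (F.eval (n : ℤ)).toNat : ℝ) ≤ T) with hS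
  have hN1 : (1 : ℝ) ≤ N := by exact_mod_cast (show 1 ≤ N by omega)
  have hN0 : (0 : ℝ) < N := by linarith
  have hD0 : (0 : ℝ) < 18 * (D : ℝ) + 1 := by positivity
  have he₀0 : 0 < e₀ := by rw [he₀]; positivity
  have he₀1 : e₀ ≤ 1 / 24 := by
    rw [he₀, div_le_div_iff₀ (by positivity) (by norm_num), one_mul, one_mul]
    have : (1 : ℝ) ≤ D := by exact_mod_cast hD1
    nlinarith
  have hz₀1 : 1 ≤ z₀ := Real.one_le_rpow hN1 he₀0.le
  have hT1 : 1 ≤ T := Real.one_le_rpow hN1 (by norm_num)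
  have hT0 : 0 < T := by linarith
  have hTN : T ≤ N := by
    calc T ≤ (N : ℝ) ^ (1 : ℝ) := Real.rpow_le_rpow_of_exponent_le hN1 (by norm_num)
      _ = N := Real.rpow_one _
  -- Step 1: pointwise weights
  have hpt : ∀ n ∈ S, G (F.eval (n : ℤ)).toNat ≤ Cg * (N : ℝ) ^ (1 / 24 : ℝ) := by
    intro n hn
    rw [hS, Finset.mem_filter, Finset.mem_Icc] at hn
    exact hW G hG0 hG1 hGmul hGA N n (by omega) hn.1.2 (hpos n hn.1.1)
  -- Step 2: `S` is covered by the large-prime-power sets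
  set aP : ℕ → ℕ := fun P => ⌊Real.log T / Real.log P⌋₊ + 1 with haP
  set setP : ℕ → Finset ℕ := fun P => (Icc 1 N).filter (fun n : ℕ => ((P : ℤ) ^ aP P) ∣ F.eval (n : ℤ))
    with hsetP
  have hcover : S ⊆ (Nat.primesBelow ⌈z₀⌉₊).biUnion setP := by
    intro n hn
    rw [hS, Finset.mem_filter, Finset.mem_Icc] at hn
    obtain ⟨hnI, hsq, hPz, hcT⟩ := hn
    set m := (F.eval (n : ℤ)).toNat with hm
    have hmpos : 0 < F.eval (n : ℤ) := hpos n hnI.1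
    obtain ⟨hm2, hZ1⟩ := two_le_of_sqrt_lt (show 1 ≤ N by omega) hsq
    obtain ⟨hPmem, hcZ, hZlt, hcd, hcop, hcprimes, hdprimes, hsmall⟩ := cut_facts hm2 hZ1 hsq
    set P := Shiu.cutPrime (Real.sqrt N) m with hPdef
    set c := Shiu.cPart (Real.sqrt N) m with hcdef
    have hP : P.Prime := Nat.prime_of_mem_primeFactors hPmem
    have hP2 : (2 : ℝ) ≤ P := by exact_mod_cast hP.two_le
    have hlogP : 0 < Real.log P := Real.log_pos (by linarith)
    have hc0 : (0 : ℝ) < c := by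
      have : c ≠ 0 := Shiu.cPart_ne_zero
      exact_mod_cast Nat.pos_of_ne_zero this
    rw [Finset.mem_biUnion]
    refine ⟨P, ?_, ?_⟩
    · rw [Nat.mem_primesBelow]
      exact ⟨(Nat.lt_ceil).2 hPz, hP⟩
    · rw [hsetP, Finset.mem_filter, Finset.mem_Icc]
      refine ⟨hnI, ?_⟩
      -- `T < P^e` with `e = v_P(m)`
      set e := m.factorization P with hedef
      have hTlt : T < (P : ℝ) ^ e := by
        by_contra hle
        rw [not_lt] at hle
        have : (c : ℝ) * (P : ℝ) ^ e ≤ T * T := mul_le_mul hcT hle (by positivity) hT0.le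
        have hTT : T * T = Real.sqrt N := by
          rw [hT, ← Real.rpow_add hN0, Real.sqrt_eq_rpow]; norm_num
        linarith
      -- `aP ≤ e`
      have haPe : aP P ≤ e := by
        have h1 : ((aP P - 1 : ℕ) : ℝ) ≤ Real.log T / Real.log P := by
          simp only [haP, Nat.add_sub_cancel]
          exact Nat.floor_le (div_nonneg (Real.log_nonneg hT1) hlogP.le)
        have h2 : (P : ℝ) ^ (aP P - 1) ≤ T := by
          rw [le_div_iff₀ hlogP, ← Real.log_pow] at h1
          exact (Real.log_le_log_iff (by positivity) hT0).1 h1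
        have h3 : (P : ℝ) ^ (aP P - 1) < (P : ℝ) ^ e := h2.trans_lt hTlt
        have h4 : aP P - 1 < e := (pow_lt_pow_iff_right₀ (by linarith : (1 : ℝ) < P)).1 h3
        omega
      have h5 : P ^ aP P ∣ m := (pow_dvd_pow P haPe).trans (Nat.ordProj_dvd m P)
      have h6 : (F.eval (n : ℤ)) = (m : ℤ) := (Int.toNat_of_nonneg hmpos.le).symm
      rw [h6]
      exact_mod_cast h5
  -- Step 3: counting
  have hcard : (#S : ℝ) ≤ 4 * M * z₀ * N / T := by
    have h1 : #S ≤ ∑ P ∈ Nat.primesBelow ⌈z₀⌉₊, #(setP P) :=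
      (Finset.card_le_card hcover).trans Finset.card_biUnion_le
    have h2 : ∀ P ∈ Nat.primesBelow ⌈z₀⌉₊, (#(setP P) : ℝ) ≤ M * (N / T + 1) := fun P hP =>
      card_largePrimePower_le hM (Nat.mem_primesBelow.1 hP).2 hT1 N
    have h3 : (#(Nat.primesBelow ⌈z₀⌉₊) : ℝ) ≤ 2 * z₀ := by
      have h4 : #(Nat.primesBelow ⌈z₀⌉₊) ≤ ⌈z₀⌉₊ := by
        calc #(Nat.primesBelow ⌈z₀⌉₊) ≤ #(range ⌈z₀⌉₊) := Finset.card_le_card (Finset.filter_subset _ _)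
          _ = ⌈z₀⌉₊ := Finset.card_range _
      have h5 : (⌈z₀⌉₊ : ℝ) < z₀ + 1 := Nat.ceil_lt_add_one (by linarith)
      have h6 : (#(Nat.primesBelow ⌈z₀⌉₊) : ℝ) ≤ ⌈z₀⌉₊ := by exact_mod_cast h4
      linarith
    have hNT : 1 ≤ (N : ℝ) / T := by rw [le_div_iff₀ hT0]; linarith
    calc (#S : ℝ) ≤ ((∑ P ∈ Nat.primesBelow ⌈z₀⌉₊, #(setP P) : ℕ) : ℝ) := by exact_mod_cast h1
      _ = ∑ P ∈ Nat.primesBelow ⌈z₀⌉₊, (#(setP P) : ℝ) := by push_cast; rfl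
      _ ≤ ∑ _P ∈ Nat.primesBelow ⌈z₀⌉₊, (M : ℝ) * (N / T + 1) := Finset.sum_le_sum h2
      _ = #(Nat.primesBelow ⌈z₀⌉₊) * ((M : ℝ) * (N / T + 1)) := by rw [Finset.sum_const, nsmul_eq_mul]
      _ ≤ (2 * z₀) * ((M : ℝ) * (N / T + 1)) := mul_le_mul_of_nonneg_right h3 (by positivity)
      _ ≤ (2 * z₀) * ((M : ℝ) * (2 * (N / T))) := by
          refine mul_le_mul_of_nonneg_left (mul_le_mul_of_nonneg_left (by linarith) (by positivity)) (by positivity)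
      _ = 4 * M * z₀ * N / T := by ring
  -- Step 4: assemble, `z₀ N / T · N^{1/24} = N^{e₀ + 3/4 + 1/24} ≤ N^{5/6}`
  have hexp : z₀ * N / T * (N : ℝ) ^ (1 / 24 : ℝ) ≤ (N : ℝ) ^ (5 / 6 : ℝ) := by
    have h1 : z₀ * N / T * (N : ℝ) ^ (1 / 24 : ℝ) = (N : ℝ) ^ (e₀ + 1 - 1 / 4 + 1 / 24) := by
      rw [hz₀, hT, Real.rpow_add hN0, Real.rpow_sub hN0, Real.rpow_add hN0, Real.rpow_one]
    rw [h1]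
    exact Real.rpow_le_rpow_of_exponent_le hN1 (by linarith)
  calc ∑ n ∈ S, G (F.eval (n : ℤ)).toNat ≤ ∑ _n ∈ S, Cg * (N : ℝ) ^ (1 / 24 : ℝ) := Finset.sum_le_sum hpt
    _ = #S * (Cg * (N : ℝ) ^ (1 / 24 : ℝ)) := by rw [Finset.sum_const, nsmul_eq_mul]
    _ ≤ (4 * M * z₀ * N / T) * (Cg * (N : ℝ) ^ (1 / 24 : ℝ)) := mul_le_mul_of_nonneg_right hcard (by positivity)
    _ = 4 * M * Cg * (z₀ * N / T * (N : ℝ) ^ (1 / 24 : ℝ)) := by ring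
    _ ≤ 4 * M * Cg * (N : ℝ) ^ (5 / 6 : ℝ) := mul_le_mul_of_nonneg_left hexp (by positivity)

/-- **Class III** (`c > N^{1/4}`, `P ≤ L`): `Σ ≤ C(L) N^{23/24}`. [folklore] -/
theorem class3_le (hd : 1 ≤ F.natDegree) (hpos : ∀ n : ℕ, 1 ≤ n → 0 < F.eval (n : ℤ))
    (hM : ∀ p : ℕ, p.Prime → ∀ a : ℕ, 1 ≤ a → polyRootCountMod ![F] (p ^ a) ≤ M) (hM1 : 1 ≤ M) (hA : 1 ≤ A)
    {L : ℝ} (hL : 2 ≤ L) :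
    ∃ C : ℝ, 0 < C ∧ ∀ G : ℕ → ℝ, (∀ n, 0 ≤ G n) → G 1 = 1 →
      (∀ m n : ℕ, m.Coprime n → G (m * n) = G m * G n) →
      (∀ p : ℕ, p.Prime → ∀ v : ℕ, 1 ≤ v → G (p ^ v) ≤ A) →
      ∀ N : ℕ, 2 ≤ N →
        ∑ n ∈ (Icc 1 N).filter (fun n : ℕ => Real.sqrt N < (F.eval (n : ℤ)).toNat ∧
              (N : ℝ) ^ (1 / 4 : ℝ) < (Shiu.cPart (Real.sqrt N) (F.eval (n : ℤ)).toNat : ℝ) ∧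
              (Shiu.cutPrime (Real.sqrt N) (F.eval (n : ℤ)).toNat : ℝ) ≤ L),
            G (F.eval (n : ℤ)).toNat ≤ C * (N : ℝ) ^ (23 / 24 : ℝ) := by
  obtain ⟨Cg, hCg, hW⟩ := weight_global_le hd hA
  refine ⟨3 * Real.exp (5 * M * L) * Cg, by positivity, ?_⟩
  intro G hG0 hG1 hGmul hGA N hN
  set Y : ℝ := (N : ℝ) ^ (1 / 4 : ℝ) with hY
  set S := (Icc 1 N).filter (fun n : ℕ => Real.sqrt N < (F.eval (n : ℤ)).toNat ∧
      Y < (Shiu.cPart (Real.sqrt N) (F.eval (n : ℤ)).toNat : ℝ) ∧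
      (Shiu.cutPrime (Real.sqrt N) (F.eval (n : ℤ)).toNat : ℝ) ≤ L) with hS
  have hN1 : (1 : ℝ) ≤ N := by exact_mod_cast (show 1 ≤ N by omega)
  have hN0 : (0 : ℝ) < N := by linarith
  have hY0 : 0 < Y := Real.rpow_pos_of_pos hN0 _
  have hsqrtN : Real.sqrt N ≤ N := by
    rw [Real.sqrt_le_left (by linarith)]; nlinarith
  -- pointwise weights
  have hpt : ∀ n ∈ S, G (F.eval (n : ℤ)).toNat ≤ Cg * (N : ℝ) ^ (1 / 24 : ℝ) := by
    intro n hn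
    rw [hS, Finset.mem_filter, Finset.mem_Icc] at hn
    exact hW G hG0 hG1 hGmul hGA N n (by omega) hn.1.2 (hpos n hn.1.1)
  -- the smooth parts
  set cf : ℕ → ℕ := fun n => Shiu.cPart (Real.sqrt N) (F.eval (n : ℤ)).toNat with hcf
  have hcf_facts : ∀ n ∈ S, (cf n ∣ (F.eval (n : ℤ)).toNat) ∧ cf n ≠ 0 ∧ Y < (cf n : ℝ) ∧ (cf n : ℝ) ≤ Real.sqrt N ∧
      (∀ p ∈ (cf n).primeFactors, (p : ℝ) < L) ∧ 0 < F.eval (n : ℤ) := by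
    intro n hn
    rw [hS, Finset.mem_filter, Finset.mem_Icc] at hn
    obtain ⟨hnI, hsq, hYc, hPL⟩ := hn
    obtain ⟨hm2, hZ1⟩ := two_le_of_sqrt_lt (show 1 ≤ N by omega) hsq
    obtain ⟨hPmem, hcZ, hZlt, hcd, hcop, hcprimes, hdprimes, hsmall⟩ := cut_facts hm2 hZ1 hsq
    refine ⟨⟨Shiu.dPart (Real.sqrt N) (F.eval (n : ℤ)).toNat, hcd.symm⟩, Shiu.cPart_ne_zero, hYc, hcZ,
      fun p hp => ?_, hpos n hnI.1⟩
    have h1 : p < Shiu.cutPrime (Real.sqrt ↑N) (F.eval (n : ℤ)).toNat := hcprimes p hp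
    have h2 : (p : ℝ) < Shiu.cutPrime (Real.sqrt ↑N) (F.eval (n : ℤ)).toNat := by exact_mod_cast h1
    exact h2.trans_le hPL
  -- fibres: `#{n ∈ S : cf n = c} ≤ 3 N ρ(c)/c`
  have hfib : ∀ c ∈ S.image cf, (#(S.filter (fun n => cf n = c)) : ℝ) ≤ 3 * N * (polyRootCountMod ![F] c : ℝ) / c := by
    intro c hc
    rw [Finset.mem_image] at hc
    obtain ⟨n₀, hn₀, rfl⟩ := hc
    obtain ⟨-, hc0, hYc, hcZ, -, -⟩ := hcf_facts n₀ hn₀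
    have hcpos : 0 < cf n₀ := Nat.pos_of_ne_zero hc0
    have hcR : (0 : ℝ) < cf n₀ := by exact_mod_cast hcpos
    have hcN : (cf n₀ : ℝ) ≤ N := hcZ.trans hsqrtN
    -- the fibre lies in the multiples of `c` among the values on `range (N+1)`
    have hsub : S.filter (fun n => cf n = cf n₀) ⊆
        (range (N + 1)).filter (fun n : ℕ => ((cf n₀ : ℕ) : ℤ) ∣ F.eval (n : ℤ)) := by
      intro n hn
      rw [Finset.mem_filter] at hn
      obtain ⟨hnS, hneq⟩ := hn
      obtain ⟨hdvd, -, -, -, -, hposn⟩ := hcf_facts n hnS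
      rw [hS, Finset.mem_filter, Finset.mem_Icc] at hnS
      rw [Finset.mem_filter, Finset.mem_range]
      refine ⟨by omega, ?_⟩
      rw [← hneq, ← Int.toNat_of_nonneg hposn.le]
      exact_mod_cast hdvd
    have h1 := (Finset.card_le_card hsub).trans
      (Summit.Parity.BatemanHorn.Theorems.AlmostPrimeZeros.SystemMertens.card_filter_range_dvd_eval_le F hcpos (N + 1))
    have h2 : (((N + 1) / cf n₀ : ℕ) : ℝ) ≤ (N : ℝ) / cf n₀ + 1 := by
      calc (((N + 1) / cf n₀ : ℕ) : ℝ) ≤ ((N + 1 : ℕ) : ℝ) / cf n₀ := Nat.cast_div_le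
        _ = (N : ℝ) / cf n₀ + 1 / cf n₀ := by push_cast; ring
        _ ≤ (N : ℝ) / cf n₀ + 1 := by
            have : 1 / (cf n₀ : ℝ) ≤ 1 := by
              rw [div_le_one hcR]; exact_mod_cast hcpos
            linarith
    have hNc : 1 ≤ (N : ℝ) / cf n₀ := by rw [le_div_iff₀ hcR]; linarith
    have hρ0 : (0 : ℝ) ≤ polyRootCountMod ![F] (cf n₀) := Nat.cast_nonneg _
    calc (#(S.filter (fun n => cf n = cf n₀)) : ℝ)
        ≤ ((polyRootCountMod ![F] (cf n₀) * ((N + 1) / cf n₀ + 1) : ℕ) : ℝ) := by exact_mod_cast h1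
      _ = (polyRootCountMod ![F] (cf n₀) : ℝ) * ((((N + 1) / cf n₀ : ℕ) : ℝ) + 1) := by push_cast; ring
      _ ≤ (polyRootCountMod ![F] (cf n₀) : ℝ) * ((N : ℝ) / cf n₀ + 1 + 1) :=
          mul_le_mul_of_nonneg_left (by linarith) hρ0
      _ ≤ (polyRootCountMod ![F] (cf n₀) : ℝ) * (3 * ((N : ℝ) / cf n₀)) :=
          mul_le_mul_of_nonneg_left (by linarith) hρ0
      _ = 3 * N * (polyRootCountMod ![F] (cf n₀) : ℝ) / cf n₀ := by ring
  -- Rankin on the image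
  have hrank := rankin_rho_smooth F hM hM1 hL hY0 (S.image cf) (fun c hc => by
    rw [Finset.mem_image] at hc
    obtain ⟨n, hn, rfl⟩ := hc
    obtain ⟨-, hc0, hYc, -, hprimes, -⟩ := hcf_facts n hn
    exact ⟨hc0, hYc, hprimes⟩)
  -- counting
  have hcard : (#S : ℝ) ≤ 3 * N * (Y ^ (-(1 / 3 : ℝ)) * Real.exp (5 * M * L)) := by
    rw [Finset.card_eq_sum_card_image cf S]
    push_cast
    calc ∑ c ∈ S.image cf, (#(S.filter (fun n => cf n = c)) : ℝ)
        ≤ ∑ c ∈ S.image cf, 3 * N * (polyRootCountMod ![F] c : ℝ) / c := Finset.sum_le_sum hfib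
      _ = 3 * N * ∑ c ∈ S.image cf, (polyRootCountMod ![F] c : ℝ) / c := by
          rw [Finset.mul_sum]; refine Finset.sum_congr rfl fun c _ => ?_; ring
      _ ≤ 3 * N * (Y ^ (-(1 / 3 : ℝ)) * Real.exp (5 * M * L)) := mul_le_mul_of_nonneg_left hrank (by positivity)
  have hexp : N * Y ^ (-(1 / 3 : ℝ)) * (N : ℝ) ^ (1 / 24 : ℝ) = (N : ℝ) ^ (23 / 24 : ℝ) := by
    rw [hY, ← Real.rpow_mul hN0.le]
    conv_lhs => rw [show (N : ℝ) = (N : ℝ) ^ (1 : ℝ) by rw [Real.rpow_one]]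
    rw [← Real.rpow_mul hN0.le, ← Real.rpow_add hN0, ← Real.rpow_mul hN0.le, ← Real.rpow_add hN0]
    norm_num
  calc ∑ n ∈ S, G (F.eval (n : ℤ)).toNat ≤ ∑ _n ∈ S, Cg * (N : ℝ) ^ (1 / 24 : ℝ) := Finset.sum_le_sum hpt
    _ = #S * (Cg * (N : ℝ) ^ (1 / 24 : ℝ)) := by rw [Finset.sum_const, nsmul_eq_mul]
    _ ≤ (3 * N * (Y ^ (-(1 / 3 : ℝ)) * Real.exp (5 * M * L))) * (Cg * (N : ℝ) ^ (1 / 24 : ℝ)) :=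
        mul_le_mul_of_nonneg_right hcard (by positivity)
    _ = 3 * Real.exp (5 * M * L) * Cg * (N * Y ^ (-(1 / 3 : ℝ)) * (N : ℝ) ^ (1 / 24 : ℝ)) := by ring
    _ = 3 * Real.exp (5 * M * L) * Cg * (N : ℝ) ^ (23 / 24 : ℝ) := by rw [hexp]

end Main

/-- **Registered form** (`--supports stmt-Parity-11292`): classes 0 / II / III (power savings). [folklore] -/
theorem nair_class0_le : ∀ (F : ℤ[X]) (A : ℝ), 1 ≤ F.natDegree → 1 ≤ A → ∃ C : ℝ, 0 < C ∧ ∀ G : ℕ → ℝ, (∀ n, 0 ≤ G n) → G 1 = 1 → (∀ m n : ℕ, m.Coprime n → G (m * n) = G m * G n) → (∀ p : ℕ, p.Prime → ∀ v : ℕ, 1 ≤ v → G (p ^ v) ≤ A) → ∀ N : ℕ, 1 ≤ N → ∑ n ∈ (Icc 1 N).filter (fun n : ℕ => 0 < F.eval (n : ℤ) ∧ ((F.eval (n : ℤ)).toNat : ℝ) ≤ Real.sqrt N), G (F.eval (n : ℤ)).toNat ≤ C * (N : ℝ) ^ (3 / 4 : ℝ) :=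
  fun _F _A hd hA => class0_le hd hA

end

end Summit.Parity.BatemanHorn.Cruxes.SystemLSDRealSegment.BetaThinnedRootKernel.Nair
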